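import Mathlib
import HarnessLib
import Summits.NavierStokesRegularity.NavierStokesRegularity.Theorems.PoloidalWindowDoorLrcModEntireTwistingTHPlaneOscillation

/-!
# Item `LrcModEntire` (stmt-NavierStokesRegularity-20428), skeleton twist_split v6, CLASS road to `stub_twistingTHGerm` —
# the ENVELOPE (touching) step and the plane-oscillation law (OSC) in pointwise form

Cell ns-regularity-ideate, seat ns-k2-port-2 g3 (sequel of `…TwistingTHPlaneOscillation`, bricks B1/B2 of the LEAD ns-poloidal-K2-p3 g12;
`--supports stmt-NavierStokesRegularity-20428 --as helper`).  LEAD memo NORMALFORM-TH-g12 §6: with `W = (1−μ)v₂`, at a plane-argmax `x⁺` of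
`W(t,·)` one has `∇ₕW = 0`, `ΔₕW ≤ 0` (B2), and — THE ENVELOPE STEP — `∂ₜW(x⁺) = ∂ₜM_W`, `∂₂W(x⁺) = ∂_zM_W`, `∂₂∂₂W(x⁺) ≤ ∂_z∂_zM_W` for the
plane supremum `M_W(t,z)` wherever it is attained and smooth; hence (SUB_W) `∂ₜM_W + M∂_zM_W − ∂_zzM_W ≤ 𝒜 − (μ_z/2)M²`, dually (SUP_W), and
subtracting, every zeroth-order term cancels into a divergence: (OSC) `∂ₜO + ½∂_z(S·O) − ∂_zzO ≤ 0`, `O = M_W − m_W`, `S = M + m`.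

This file proves the CLASSICAL-TOUCHING version (the viscosity version stays prose): 1-D touching lemmas `deriv_eq_of_touching`,
`deriv_deriv_le_of_touching`; `deriv_deriv_line_eq` (second derivative along the vertical line = `∂₂∂₂`); and
* `osc_sub_sup` — **(SUB_W) − (SUP_W)**: if `M, m : ℝ → ℝ → ℝ` dominate / minorise `W` near `(t,x⁺)` / `(t,x⁻)` through the height
  (`W(s,y) ≤ M(s,y₂)`, `m(s,y₂) ≤ W(s,y)`) with equality at `x⁺`, `x⁻` (two points of ONE plane near which (TH) holds), and are differentiable in
  time and twice in height there, then
  `[∂ₜM + v₂(x⁺)∂_zM − ∂_zzM](t,c) − [∂ₜm + v₂(x⁻)∂_zm − ∂_zzm](t,c) ≤ −(μ_z(t,c)/2)(v₂(x⁺)² − v₂(x⁻)²)` (B1+B2 = `osc_twoPoint` + touching);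
* `osc_divergence_form` — the algebra of the LEAD's last step: if moreover `M = (1−μ)Θ⁺`, `m = (1−μ)Θ⁻` with `v₂(x±) = Θ±(t,c)` (plane sup/inf of
  `v₂`; `1−μ > 0` is constant on the plane), then with `O := M − m`, `S := Θ⁺ + Θ⁻`: `∂ₜO + ½∂_z(S·O) − ∂_zzO ≤ 0` at `(t,c)`.

WHAT THIS IS NOT: not a claim about Navier–Stokes regularity and not the stub — calculus on the stratum (TH) under explicit attainment/regularity
hypotheses on the plane extrema (bears_on LADDER-NS N0, item 20428 / crux 19708; the Liouville endgame of (OSC) — the «K < 1/2» wall — is NOT here).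
-/

noncomputable section

-- the summit and its single sub-problem share the name (CONVENTIONS §1), as in every Theorems file
set_option linter.dupNamespace false

namespace Summit.NavierStokesRegularity.NavierStokesRegularity.Theorems.PoloidalWindowDoorLrcModEntireTwistingTHPlaneOscillationEnvelope

open MeasureTheory Set Function Filter Topology Metric InnerProductSpace
open scoped RealInnerProductSpace InnerProductSpace Laplacian ContDiff
open Literature.Analysis Literature.Analysis.FluidPDE
open Summit.NavierStokesRegularity.NavierStokesRegularity.Theorems.LocalSineTubeDoorProfileAlignedWindowRigidityAncient
open Summit.NavierStokesRegularity.NavierStokesRegularity.Theorems.PoloidalWindowDoorPoloidalWindowRigidityWindow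
open Summit.NavierStokesRegularity.NavierStokesRegularity.Theorems.PoloidalWindowDoorPoloidalWindowRigidityVelocityGradientLaw
open Summit.NavierStokesRegularity.NavierStokesRegularity.Theorems.PoloidalWindowDoorPoloidalWindowRigidityTimeHeightShearPressure
open Summit.NavierStokesRegularity.NavierStokesRegularity.Theorems.PoloidalWindowDoorPoloidalWindowRigiditySlopeFunctionPressure
open Summit.NavierStokesRegularity.NavierStokesRegularity.Theorems.PoloidalWindowDoorPoloidalWindowRigidityTimeHeightShearWeight
open Summit.NavierStokesRegularity.NavierStokesRegularity.Theorems.PoloidalWindowDoorLrcModEntireTwistingTHPlaneOscillation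

/-! ### One-dimensional touching lemmas -/
section Touching

variable {f g : ℝ → ℝ} {c : ℝ}

/-- **First-order touching**: `f ≤ g` near `c` with `f(c) = g(c)`, both differentiable at `c` ⇒ `f′(c) = g′(c)`. -/
theorem deriv_eq_of_touching (hle : ∀ᶠ z in 𝓝 c, f z ≤ g z) (heq : f c = g c)
    (hf : DifferentiableAt ℝ f c) (hg : DifferentiableAt ℝ g c) : deriv f c = deriv g c := by
  have hmax : IsLocalMax (fun z => f z - g z) c := by
    filter_upwards [hle] with z hz
    simp only [heq, sub_self]; linarith
  have h := hmax.deriv_eq_zero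
  rw [deriv_fun_sub hf hg] at h
  linarith

/-- **Second-order touching**: `f ≤ g` near `c` with `f(c) = g(c)`, both differentiable near `c` with derivatives differentiable at `c`
⇒ `f″(c) ≤ g″(c)` (the tree's `IsLocalMax.deriv_deriv_nonpos` on `f − g`). -/
theorem deriv_deriv_le_of_touching (hle : ∀ᶠ z in 𝓝 c, f z ≤ g z) (heq : f c = g c)
    (hf1 : ∀ᶠ z in 𝓝 c, DifferentiableAt ℝ f z) (hg1 : ∀ᶠ z in 𝓝 c, DifferentiableAt ℝ g z)
    (hf2 : DifferentiableAt ℝ (deriv f) c) (hg2 : DifferentiableAt ℝ (deriv g) c) :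
    deriv (deriv f) c ≤ deriv (deriv g) c := by
  have hmax : IsLocalMax (fun z => f z - g z) c := by
    filter_upwards [hle] with z hz
    simp only [heq, sub_self]; linarith
  have hcont : ContinuousAt (fun z => f z - g z) c :=
    (hf1.self_of_nhds.continuousAt).sub (hg1.self_of_nhds.continuousAt)
  have h := IsLocalMax.deriv_deriv_nonpos hmax hcont
  have h1 : deriv (fun z => f z - g z) =ᶠ[𝓝 c] fun z => deriv f z - deriv g z := by
    filter_upwards [hf1, hg1] with z hfz hgz
    exact deriv_fun_sub hfz hgz
  rw [h1.deriv_eq, deriv_fun_sub hf2 hg2] at h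
  linarith

end Touching

/-! ### The vertical line through a point -/
section Line

variable {G : EuclideanSpace ℝ (Fin 3) → ℝ} {x : EuclideanSpace ℝ (Fin 3)}

/-- The height of `x + σ e₂` is `x₂ + σ`. -/
theorem line_apply_two (σ : ℝ) :
    (x + σ • (EuclideanSpace.single 2 (1 : ℝ) : EuclideanSpace ℝ (Fin 3))) 2 = x 2 + σ := by
  simp

/-- First derivative along the vertical line: `(σ ↦ G(x + σe₂))′ = ∂₂G(x + σe₂)`. -/
theorem deriv_line_eq (hG : Differentiable ℝ G) (σ : ℝ) :
    deriv (fun σ : ℝ => G (x + σ • (EuclideanSpace.single 2 (1 : ℝ) : EuclideanSpace ℝ (Fin 3)))) σ =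
      fderiv ℝ G (x + σ • (EuclideanSpace.single 2 (1 : ℝ) : EuclideanSpace ℝ (Fin 3))) (EuclideanSpace.single 2 1) :=
  (hasDerivAt_comp_line hG x _ σ).deriv

/-- **Second derivative along the vertical line at `σ = 0` is `∂₂∂₂G(x)`** for `C²` `G`. -/
theorem deriv_deriv_line_eq (hG : ContDiff ℝ 2 G) :
    deriv (deriv (fun σ : ℝ => G (x + σ • (EuclideanSpace.single 2 (1 : ℝ) : EuclideanSpace ℝ (Fin 3))))) 0 =
      fderiv ℝ (fun y => fderiv ℝ G y (EuclideanSpace.single 2 1)) x (EuclideanSpace.single 2 1) := by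
  have hGd : Differentiable ℝ G := hG.differentiable (by norm_num)
  have h1 : deriv (fun σ : ℝ => G (x + σ • (EuclideanSpace.single 2 (1 : ℝ) : EuclideanSpace ℝ (Fin 3)))) =
      fun σ => fderiv ℝ G (x + σ • (EuclideanSpace.single 2 (1 : ℝ) : EuclideanSpace ℝ (Fin 3))) (EuclideanSpace.single 2 1) :=
    funext fun σ => deriv_line_eq hGd σ
  have hD1 : ContDiff ℝ 1 fun z => fderiv ℝ G z (EuclideanSpace.single 2 (1 : ℝ)) :=
    (hG.fderiv_right (m := 1) le_rfl).clm_apply contDiff_const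
  rw [h1]
  have h2 := hasDerivAt_comp_line (hD1.differentiable (by norm_num)) x (EuclideanSpace.single 2 (1 : ℝ)) 0
  rw [zero_smul, add_zero] at h2
  exact h2.deriv

/-- The derivative of a `C²` function of one variable is differentiable. -/
theorem differentiable_deriv_of_contDiff_two {f : ℝ → ℝ} (hf : ContDiff ℝ 2 f) : Differentiable ℝ (deriv f) := by
  have h1 : ContDiff ℝ 1 fun z => fderiv ℝ f z (1 : ℝ) := (hf.fderiv_right (m := 1) le_rfl).clm_apply contDiff_const
  have e : deriv f = fun z => fderiv ℝ f z (1 : ℝ) := rfl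
  rw [e]
  exact h1.differentiable (by norm_num)

end Line

/-! ### The class setting -/
section Class

variable {C : ℝ} {v : ℝ → EuclideanSpace ℝ (Fin 3) → EuclideanSpace ℝ (Fin 3)}
variable (hrate : HasTypeITimeDecay C v) (hcont : ContinuousOn (uncurry v) (Iio (0 : ℝ) ×ˢ univ))
  (hmild : ∀ s t : ℝ, s < t → t < 0 → ∀ x,
    v t x = UnboundedOperators.heatExtension (v s) (t - s) x - oseenDuhamel 1 s v v t x)
  (hdiv : ∀ t < 0, VectorCalculus.IsDivFree (v t))
  (hpol : ∀ s < 0, ∀ y, ⟪curl (v s) y, EuclideanSpace.single 2 1⟫_ℝ = 0)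
  {μ : ℝ → ℝ → ℝ} (hμ : ContDiff ℝ 3 (uncurry μ))

include hrate hcont hmild hdiv

/-- The time slice `s ↦ W(s,x) = (1 − μ(s,x₂))·v₂(s,x)` is differentiable at `t < 0` (μ jointly `C¹`). -/
theorem differentiableAt_W_time {μ : ℝ → ℝ → ℝ} (hμ1 : ContDiff ℝ 1 (uncurry μ)) {t : ℝ} (ht : t < 0)
    (x : EuclideanSpace ℝ (Fin 3)) :
    DifferentiableAt ℝ (fun s => (1 - μ s (x 2)) * v s x 2) t := by
  have hμs : DifferentiableAt ℝ (fun s => μ s (x 2)) t := by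
    have h' : DifferentiableAt ℝ (uncurry μ ∘ fun s : ℝ => (s, x 2)) t :=
      ((hμ1.differentiable (by norm_num)) _).comp t (differentiableAt_id.prodMk (differentiableAt_const _))
    simpa [Function.comp_def] using h'
  exact (hμs.const_sub 1).mul (differentiableAt_vert_time hrate hcont hmild hdiv ht x)

include hpol hμ

/-- **(SUB_W) − (SUP_W): the two-point plane-oscillation inequality after the ENVELOPE step.**  Let `x⁺, x⁻` lie on one horizontal
plane `{y₂ = c}` of the slice `t < 0`, near which (TH) holds with slope `μ` (jointly `C³`).  Let `M, m : ℝ → ℝ → ℝ` (functions of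
`(time, height)`) satisfy, with `W(s,y) := (1 − μ(s,y₂))v₂(s,y)`:  `W(s,y) ≤ M(s,y₂)` for `(s,y)` near `(t,x⁺)` with equality at `(t,x⁺)`,
and `m(s,y₂) ≤ W(s,y)` near `(t,x⁻)` with equality at `(t,x⁻)` (so `x⁺`/`x⁻` are local plane max/min of `W(t,·)` and `M`/`m` are upper/lower
envelopes through the height — e.g. the plane sup/inf when attained); assume `s ↦ M(s,c)`, `s ↦ m(s,c)` differentiable at `t` and `M(t,·)`,
`m(t,·)` differentiable near `c` with derivatives differentiable at `c`.  Then
`[∂ₜM + v₂(t,x⁺)·∂_zM − ∂_z∂_zM](t,c) − [∂ₜm + v₂(t,x⁻)·∂_zm − ∂_z∂_zm](t,c) ≤ −(μ_z(t,c)/2)·(v₂(t,x⁺)² − v₂(t,x⁻)²)`. -/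
theorem osc_sub_sup {t : ℝ} (ht : t < 0) {c : ℝ} {xp xm : EuclideanSpace ℝ (Fin 3)} (hxp : xp 2 = c) (hxm : xm 2 = c)
    (hslope : ∀ y : EuclideanSpace ℝ (Fin 3), y 2 = c →
      ∀ᶠ z in 𝓝 ((t, y) : ℝ × EuclideanSpace ℝ (Fin 3)), ∀ b : Fin 3, b ≠ 2 →
        fderiv ℝ (v z.1) z.2 (EuclideanSpace.single 2 1) b =
          μ z.1 (z.2 2) * fderiv ℝ (v z.1) z.2 (EuclideanSpace.single b 1) 2)
    {M m : ℝ → ℝ → ℝ}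
    (hM : ∀ᶠ q in 𝓝 ((t, xp) : ℝ × EuclideanSpace ℝ (Fin 3)), (1 - μ q.1 (q.2 2)) * v q.1 q.2 2 ≤ M q.1 (q.2 2))
    (hMeq : (1 - μ t (xp 2)) * v t xp 2 = M t c)
    (hm : ∀ᶠ q in 𝓝 ((t, xm) : ℝ × EuclideanSpace ℝ (Fin 3)), m q.1 (q.2 2) ≤ (1 - μ q.1 (q.2 2)) * v q.1 q.2 2)
    (hmeq : (1 - μ t (xm 2)) * v t xm 2 = m t c)
    (hMt : DifferentiableAt ℝ (fun s => M s c) t) (hmt : DifferentiableAt ℝ (fun s => m s c) t)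
    (hM1 : ∀ᶠ z in 𝓝 c, DifferentiableAt ℝ (M t) z) (hm1 : ∀ᶠ z in 𝓝 c, DifferentiableAt ℝ (m t) z)
    (hM2 : DifferentiableAt ℝ (deriv (M t)) c) (hm2 : DifferentiableAt ℝ (deriv (m t)) c) :
    (deriv (fun s => M s c) t + v t xp 2 * deriv (M t) c - deriv (deriv (M t)) c)
      - (deriv (fun s => m s c) t + v t xm 2 * deriv (m t) c - deriv (deriv (m t)) c) ≤
      -(deriv (μ t) c / 2) * (v t xp 2 ^ 2 - v t xm 2 ^ 2) := by
  have hμ2 : ContDiff ℝ 2 (uncurry μ) := hμ.of_le (by norm_cast)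
  have hμ1 : ContDiff ℝ 1 (uncurry μ) := hμ.of_le (by norm_cast)
  have hμt3 : ContDiff ℝ 3 (μ t) := hμ.comp (contDiff_const.prodMk contDiff_id)
  have hμt2 : ContDiff ℝ 2 (μ t) := hμt3.of_le (by norm_cast)
  -- `W(t,·)` and its regularity
  set Wt : EuclideanSpace ℝ (Fin 3) → ℝ := fun y => (1 - μ t (y 2)) * v t y 2 with hWt
  have hW2 : ContDiff ℝ 2 Wt := contDiff_W_slice hrate hcont hmild hdiv hμt2 ht
  have hWd : Differentiable ℝ Wt := hW2.differentiable (by norm_num)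
  have hW1c : ContDiff ℝ 1 fun y => fderiv ℝ Wt y (EuclideanSpace.single 2 (1 : ℝ)) :=
    (hW2.fderiv_right (m := 1) le_rfl).clm_apply contDiff_const
  set e₂ : EuclideanSpace ℝ (Fin 3) := EuclideanSpace.single 2 (1 : ℝ) with he₂
  have hxpm : xp 2 = xm 2 := by rw [hxp, hxm]
  have hmax : IsLocalMaxOn Wt {y : EuclideanSpace ℝ (Fin 3) | y 2 = xp 2} xp := by
    have hc' : ContinuousAt (fun y : EuclideanSpace ℝ (Fin 3) => ((t, y) : ℝ × EuclideanSpace ℝ (Fin 3))) xp := by fun_prop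
    have h1 : ∀ᶠ y in 𝓝 xp, Wt y ≤ M t (y 2) := by
      have h := hc'.eventually hM
      filter_upwards [h] with y hy
      simpa [hWt] using hy
    have h2 : ∀ᶠ y in 𝓝[{y : EuclideanSpace ℝ (Fin 3) | y 2 = xp 2}] xp, Wt y ≤ Wt xp := by
      filter_upwards [nhdsWithin_le_nhds h1, self_mem_nhdsWithin] with y hy hy2
      have hy2' : y 2 = c := by rw [show y 2 = xp 2 from hy2, hxp]
      rw [hy2'] at hy
      have : Wt xp = M t c := by simpa [hWt] using hMeq
      linarith
    exact h2
  have hmin : IsLocalMinOn Wt {y : EuclideanSpace ℝ (Fin 3) | y 2 = xm 2} xm := by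
    have hc' : ContinuousAt (fun y : EuclideanSpace ℝ (Fin 3) => ((t, y) : ℝ × EuclideanSpace ℝ (Fin 3))) xm := by fun_prop
    have h1 : ∀ᶠ y in 𝓝 xm, m t (y 2) ≤ Wt y := by
      have h := hc'.eventually hm
      filter_upwards [h] with y hy
      simpa [hWt] using hy
    have h2 : ∀ᶠ y in 𝓝[{y : EuclideanSpace ℝ (Fin 3) | y 2 = xm 2}] xm, Wt xm ≤ Wt y := by
      filter_upwards [nhdsWithin_le_nhds h1, self_mem_nhdsWithin] with y hy hy2
      have hy2' : y 2 = c := by rw [show y 2 = xm 2 from hy2, hxm]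
      rw [hy2'] at hy
      have : Wt xm = m t c := by simpa [hWt] using hmeq
      linarith
    exact h2
  have hslope' : ∀ y : EuclideanSpace ℝ (Fin 3), y 2 = xp 2 →
      ∀ᶠ z in 𝓝 ((t, y) : ℝ × EuclideanSpace ℝ (Fin 3)), ∀ b : Fin 3, b ≠ 2 →
        fderiv ℝ (v z.1) z.2 (EuclideanSpace.single 2 1) b =
          μ z.1 (z.2 2) * fderiv ℝ (v z.1) z.2 (EuclideanSpace.single b 1) 2 := fun y hy => hslope y (by rw [hy, hxp])
  have h2pt := osc_twoPoint hrate hcont hmild hdiv hpol hμ ht hxpm hslope' hmax hmin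
  -- ### ENVELOPE, time direction: `∂ₜW(t,x⁺) = ∂ₜM(t,c)`, `∂ₜW(t,x⁻) = ∂ₜm(t,c)`
  have htp : deriv (fun s => (1 - μ s (xp 2)) * v s xp 2) t = deriv (fun s => M s c) t := by
    have hcs : ContinuousAt (fun s : ℝ => ((s, xp) : ℝ × EuclideanSpace ℝ (Fin 3))) t := by fun_prop
    have hle : ∀ᶠ s in 𝓝 t, (1 - μ s (xp 2)) * v s xp 2 ≤ M s c := by
      have h := hcs.eventually hM
      filter_upwards [h] with s hs
      simpa [hxp] using hs
    exact deriv_eq_of_touching hle hMeq (differentiableAt_W_time hrate hcont hmild hdiv hμ1 ht xp) hMt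
  have htm : deriv (fun s => (1 - μ s (xm 2)) * v s xm 2) t = deriv (fun s => m s c) t := by
    have hcs : ContinuousAt (fun s : ℝ => ((s, xm) : ℝ × EuclideanSpace ℝ (Fin 3))) t := by fun_prop
    have hle : ∀ᶠ s in 𝓝 t, m s c ≤ (1 - μ s (xm 2)) * v s xm 2 := by
      have h := hcs.eventually hm
      filter_upwards [h] with s hs
      simpa [hxm] using hs
    exact (deriv_eq_of_touching hle hmeq.symm hmt (differentiableAt_W_time hrate hcont hmild hdiv hμ1 ht xm)).symm
  -- ### ENVELOPE, height direction along the vertical lines through `x⁺`, `x⁻`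
  set ℓp : ℝ → ℝ := fun σ => Wt (xp + σ • e₂) with hℓp
  set ℓm : ℝ → ℝ := fun σ => Wt (xm + σ • e₂) with hℓm
  set Mp : ℝ → ℝ := fun σ => M t (c + σ) with hMp
  set mm : ℝ → ℝ := fun σ => m t (c + σ) with hmm
  have hℓpd : ∀ σ, DifferentiableAt ℝ ℓp σ := fun σ => (hasDerivAt_comp_line hWd xp e₂ σ).differentiableAt
  have hℓmd : ∀ σ, DifferentiableAt ℝ ℓm σ := fun σ => (hasDerivAt_comp_line hWd xm e₂ σ).differentiableAt
  have hℓp1 : deriv ℓp 0 = fderiv ℝ Wt xp e₂ := by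
    have h := deriv_line_eq (x := xp) hWd 0
    simpa [hℓp, he₂] using h
  have hℓm1 : deriv ℓm 0 = fderiv ℝ Wt xm e₂ := by
    have h := deriv_line_eq (x := xm) hWd 0
    simpa [hℓm, he₂] using h
  have hℓp2 : deriv (deriv ℓp) 0 = fderiv ℝ (fun y => fderiv ℝ Wt y e₂) xp e₂ := by
    simpa [hℓp, he₂] using deriv_deriv_line_eq (x := xp) hW2
  have hℓm2 : deriv (deriv ℓm) 0 = fderiv ℝ (fun y => fderiv ℝ Wt y e₂) xm e₂ := by
    simpa [hℓm, he₂] using deriv_deriv_line_eq (x := xm) hW2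
  have hℓp2d : DifferentiableAt ℝ (deriv ℓp) 0 := by
    have h1 : deriv ℓp = fun σ => fderiv ℝ Wt (xp + σ • e₂) e₂ := funext fun σ => by
      simpa [hℓp, he₂] using deriv_line_eq (x := xp) hWd σ
    rw [h1]
    exact (hasDerivAt_comp_line (hW1c.differentiable (by norm_num)) xp e₂ 0).differentiableAt
  have hℓm2d : DifferentiableAt ℝ (deriv ℓm) 0 := by
    have h1 : deriv ℓm = fun σ => fderiv ℝ Wt (xm + σ • e₂) e₂ := funext fun σ => by
      simpa [hℓm, he₂] using deriv_line_eq (x := xm) hWd σ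
    rw [h1]
    exact (hasDerivAt_comp_line (hW1c.differentiable (by norm_num)) xm e₂ 0).differentiableAt
  have hshift : ∀ σ : ℝ, HasDerivAt (fun σ : ℝ => c + σ) 1 σ := fun σ => by
    simpa using (hasDerivAt_id σ).const_add c
  have hMp_d : ∀ᶠ σ in 𝓝 (0 : ℝ), DifferentiableAt ℝ Mp σ := by
    have hc0 : Tendsto (fun σ : ℝ => c + σ) (𝓝 0) (𝓝 c) := by
      have h : Continuous (fun σ : ℝ => c + σ) := by fun_prop
      simpa using h.tendsto 0
    filter_upwards [hc0.eventually hM1] with σ hσ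
    exact hσ.comp σ (hshift σ).differentiableAt
  have hmm_d : ∀ᶠ σ in 𝓝 (0 : ℝ), DifferentiableAt ℝ mm σ := by
    have hc0 : Tendsto (fun σ : ℝ => c + σ) (𝓝 0) (𝓝 c) := by
      have h : Continuous (fun σ : ℝ => c + σ) := by fun_prop
      simpa using h.tendsto 0
    filter_upwards [hc0.eventually hm1] with σ hσ
    exact hσ.comp σ (hshift σ).differentiableAt
  have hMp1 : deriv Mp = fun σ => deriv (M t) (c + σ) := by
    funext σ; rw [hMp]; exact deriv_comp_const_add (M t) c σ
  have hmm1 : deriv mm = fun σ => deriv (m t) (c + σ) := by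
    funext σ; rw [hmm]; exact deriv_comp_const_add (m t) c σ
  have hMp1' : deriv Mp 0 = deriv (M t) c := by rw [hMp1]; simp
  have hmm1' : deriv mm 0 = deriv (m t) c := by rw [hmm1]; simp
  have hMp2 : deriv (deriv Mp) 0 = deriv (deriv (M t)) c := by
    rw [hMp1, deriv_comp_const_add (deriv (M t)) c 0, add_zero]
  have hmm2 : deriv (deriv mm) 0 = deriv (deriv (m t)) c := by
    rw [hmm1, deriv_comp_const_add (deriv (m t)) c 0, add_zero]
  have hMp0d : DifferentiableAt ℝ Mp 0 := hMp_d.self_of_nhds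
  have hmm0d : DifferentiableAt ℝ mm 0 := hmm_d.self_of_nhds
  have hMp2d : DifferentiableAt ℝ (deriv Mp) 0 := by
    rw [hMp1]
    have hM2' : DifferentiableAt ℝ (deriv (M t)) (c + 0) := by rw [add_zero]; exact hM2
    have h := hM2'.comp (0 : ℝ) (hshift 0).differentiableAt
    simpa [Function.comp_def] using h
  have hmm2d : DifferentiableAt ℝ (deriv mm) 0 := by
    rw [hmm1]
    have hm2' : DifferentiableAt ℝ (deriv (m t)) (c + 0) := by rw [add_zero]; exact hm2
    have h := hm2'.comp (0 : ℝ) (hshift 0).differentiableAt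
    simpa [Function.comp_def] using h
  -- touching along the lines: `ℓp ≤ Mp` near `0` with equality at `0`; `mm ≤ ℓm` likewise
  have hlineP : ContinuousAt (fun σ : ℝ => ((t, xp + σ • e₂) : ℝ × EuclideanSpace ℝ (Fin 3))) 0 := by fun_prop
  have hlineM : ContinuousAt (fun σ : ℝ => ((t, xm + σ • e₂) : ℝ × EuclideanSpace ℝ (Fin 3))) 0 := by fun_prop
  have hle_p : ∀ᶠ σ in 𝓝 (0 : ℝ), ℓp σ ≤ Mp σ := by
    have hT : Tendsto (fun σ : ℝ => ((t, xp + σ • e₂) : ℝ × EuclideanSpace ℝ (Fin 3))) (𝓝 0) (𝓝 (t, xp)) := by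
      simpa using hlineP.tendsto
    have h := hT.eventually hM
    filter_upwards [h] with σ hσ
    have e : (xp + σ • e₂) 2 = c + σ := by rw [he₂, line_apply_two, hxp]
    show Wt (xp + σ • e₂) ≤ M t (c + σ)
    have hσ' : (1 - μ t ((xp + σ • e₂) 2)) * v t (xp + σ • e₂) 2 ≤ M t ((xp + σ • e₂) 2) := hσ
    rw [e] at hσ'
    simpa only [hWt, e] using hσ'
  have hle_m : ∀ᶠ σ in 𝓝 (0 : ℝ), mm σ ≤ ℓm σ := by
    have hT : Tendsto (fun σ : ℝ => ((t, xm + σ • e₂) : ℝ × EuclideanSpace ℝ (Fin 3))) (𝓝 0) (𝓝 (t, xm)) := by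
      simpa using hlineM.tendsto
    have h := hT.eventually hm
    filter_upwards [h] with σ hσ
    have e : (xm + σ • e₂) 2 = c + σ := by rw [he₂, line_apply_two, hxm]
    show m t (c + σ) ≤ Wt (xm + σ • e₂)
    have hσ' : m t ((xm + σ • e₂) 2) ≤ (1 - μ t ((xm + σ • e₂) 2)) * v t (xm + σ • e₂) 2 := hσ
    rw [e] at hσ'
    simpa only [hWt, e] using hσ'
  have heq_p : ℓp 0 = Mp 0 := by simpa [hℓp, hMp, hWt, hxp] using hMeq
  have heq_m : mm 0 = ℓm 0 := by simpa [hℓm, hmm, hWt, hxm] using hmeq.symm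
  -- first order: `∂₂W(x⁺) = ∂_zM`, `∂₂W(x⁻) = ∂_zm`
  have hzp : fderiv ℝ Wt xp e₂ = deriv (M t) c := by
    rw [← hℓp1, ← hMp1']; exact deriv_eq_of_touching hle_p heq_p (hℓpd 0) hMp0d
  have hzm : fderiv ℝ Wt xm e₂ = deriv (m t) c := by
    rw [← hℓm1, ← hmm1']; exact (deriv_eq_of_touching hle_m heq_m hmm0d (hℓmd 0)).symm
  -- second order: `∂₂∂₂W(x⁺) ≤ ∂_zzM`, `∂_zzm ≤ ∂₂∂₂W(x⁻)`
  have hzzp : fderiv ℝ (fun y => fderiv ℝ Wt y e₂) xp e₂ ≤ deriv (deriv (M t)) c := by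
    rw [← hℓp2, ← hMp2]
    exact deriv_deriv_le_of_touching hle_p heq_p (Eventually.of_forall hℓpd) hMp_d hℓp2d hMp2d
  have hzzm : deriv (deriv (m t)) c ≤ fderiv ℝ (fun y => fderiv ℝ Wt y e₂) xm e₂ := by
    rw [← hℓm2, ← hmm2]
    exact deriv_deriv_le_of_touching hle_m heq_m hmm_d (Eventually.of_forall hℓmd) hmm2d hℓm2d
  have hc2 : deriv (μ t) (xp 2) = deriv (μ t) c := by rw [hxp]
  rw [htp, htm, hc2] at h2pt
  simp only [hWt, he₂] at hzp hzm hzzp hzzm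
  rw [hzp, hzm] at h2pt
  linarith [h2pt, hzzp, hzzm]

omit hrate hcont hmild hdiv hpol hμ in
/-- **(OSC) — THE DIVERGENCE FORM** (the LEAD's last step, pure one-variable algebra).  At a fixed time, let `a = 1 − μ(t,·)`, `Θ⁺, Θ⁻`
(plane sup / inf of `v₂`) be `C²` functions of the height and `M = aΘ⁺`, `m = aΘ⁻` (plane sup / inf of `W = a·v₂`; `a > 0` is constant on
planes); let `Mt, mt` be the time derivatives of `M, m` at height `c`.  If (SUB_W) − (SUP_W) holds at `c` in the form of `osc_sub_sup`
(with `v₂(x±) = Θ±(c)`, `−μ_z = a′`), then with `O := M − m` and `S := Θ⁺ + Θ⁻`: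
`(Mt − mt) + ½·(S·O)′(c) − O″(c) ≤ 0` — every zeroth-order term has cancelled into the divergence `½(S·O)′`. -/
theorem osc_divergence_form {a Θp Θm : ℝ → ℝ} (ha : ContDiff ℝ 2 a) (hΘp : ContDiff ℝ 2 Θp) (hΘm : ContDiff ℝ 2 Θm)
    {c Mt mt : ℝ}
    (hsub : (Mt + Θp c * deriv (fun z => a z * Θp z) c - deriv (deriv fun z => a z * Θp z) c)
      - (mt + Θm c * deriv (fun z => a z * Θm z) c - deriv (deriv fun z => a z * Θm z) c) ≤
      (deriv a c / 2) * (Θp c ^ 2 - Θm c ^ 2)) :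
    (Mt - mt) + (1 / 2) * deriv (fun z => (Θp z + Θm z) * (a z * Θp z - a z * Θm z)) c
      - deriv (deriv fun z => a z * Θp z - a z * Θm z) c ≤ 0 := by
  have had : Differentiable ℝ a := ha.differentiable (by norm_num)
  have hpd : Differentiable ℝ Θp := hΘp.differentiable (by norm_num)
  have hmd : Differentiable ℝ Θm := hΘm.differentiable (by norm_num)
  have ha' : Differentiable ℝ (deriv a) := differentiable_deriv_of_contDiff_two ha
  have hp' : Differentiable ℝ (deriv Θp) := differentiable_deriv_of_contDiff_two hΘp
  have hm' : Differentiable ℝ (deriv Θm) := differentiable_deriv_of_contDiff_two hΘm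
  -- differentiability of the products (stated with explicit lambdas, for the `deriv_fun_*` rewrites)
  have hMd : ∀ z, DifferentiableAt ℝ (fun z => a z * Θp z) z := fun z => (had z).mul (hpd z)
  have hmd' : ∀ z, DifferentiableAt ℝ (fun z => a z * Θm z) z := fun z => (had z).mul (hmd z)
  have hA1 : ∀ z, DifferentiableAt ℝ (fun z => deriv a z * Θp z) z := fun z => (ha' z).mul (hpd z)
  have hA2 : ∀ z, DifferentiableAt ℝ (fun z => a z * deriv Θp z) z := fun z => (had z).mul (hp' z)
  have hB1 : ∀ z, DifferentiableAt ℝ (fun z => deriv a z * Θm z) z := fun z => (ha' z).mul (hmd z)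
  have hB2 : ∀ z, DifferentiableAt ℝ (fun z => a z * deriv Θm z) z := fun z => (had z).mul (hm' z)
  have dM : deriv (fun z => a z * Θp z) = fun z => deriv a z * Θp z + a z * deriv Θp z :=
    funext fun z => deriv_fun_mul (had z) (hpd z)
  have dm : deriv (fun z => a z * Θm z) = fun z => deriv a z * Θm z + a z * deriv Θm z :=
    funext fun z => deriv_fun_mul (had z) (hmd z)
  have dO : deriv (fun z => a z * Θp z - a z * Θm z) =
      fun z => (deriv a z * Θp z + a z * deriv Θp z) - (deriv a z * Θm z + a z * deriv Θm z) := by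
    funext z
    rw [deriv_fun_sub (hMd z) (hmd' z), deriv_fun_mul (had z) (hpd z), deriv_fun_mul (had z) (hmd z)]
  have ddM : deriv (deriv fun z => a z * Θp z) c =
      deriv (deriv a) c * Θp c + 2 * deriv a c * deriv Θp c + a c * deriv (deriv Θp) c := by
    rw [dM, deriv_fun_add (hA1 c) (hA2 c), deriv_fun_mul (ha' c) (hpd c), deriv_fun_mul (had c) (hp' c)]
    ring
  have ddm : deriv (deriv fun z => a z * Θm z) c =
      deriv (deriv a) c * Θm c + 2 * deriv a c * deriv Θm c + a c * deriv (deriv Θm) c := by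
    rw [dm, deriv_fun_add (hB1 c) (hB2 c), deriv_fun_mul (ha' c) (hmd c), deriv_fun_mul (had c) (hm' c)]
    ring
  have hS1 : DifferentiableAt ℝ (fun z => deriv a z * Θp z + a z * deriv Θp z) c := (hA1 c).add (hA2 c)
  have hS2 : DifferentiableAt ℝ (fun z => deriv a z * Θm z + a z * deriv Θm z) c := (hB1 c).add (hB2 c)
  have ddO : deriv (deriv fun z => a z * Θp z - a z * Θm z) c =
      (deriv (deriv a) c * Θp c + 2 * deriv a c * deriv Θp c + a c * deriv (deriv Θp) c)
        - (deriv (deriv a) c * Θm c + 2 * deriv a c * deriv Θm c + a c * deriv (deriv Θm) c) := by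
    rw [dO, deriv_fun_sub hS1 hS2, deriv_fun_add (hA1 c) (hA2 c), deriv_fun_add (hB1 c) (hB2 c),
      deriv_fun_mul (ha' c) (hpd c), deriv_fun_mul (had c) (hp' c), deriv_fun_mul (ha' c) (hmd c),
      deriv_fun_mul (had c) (hm' c)]
    ring
  have hS : DifferentiableAt ℝ (fun z => Θp z + Θm z) c := (hpd c).add (hmd c)
  have hO : DifferentiableAt ℝ (fun z => a z * Θp z - a z * Θm z) c := (hMd c).sub (hmd' c)
  have dSO : deriv (fun z => (Θp z + Θm z) * (a z * Θp z - a z * Θm z)) c =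
      (deriv Θp c + deriv Θm c) * (a c * Θp c - a c * Θm c)
        + (Θp c + Θm c) * ((deriv a c * Θp c + a c * deriv Θp c) - (deriv a c * Θm c + a c * deriv Θm c)) := by
    rw [deriv_fun_mul hS hO, deriv_fun_add (hpd c) (hmd c), dO]
  have e1 : deriv (fun z => a z * Θp z) c = deriv a c * Θp c + a c * deriv Θp c := by rw [dM]
  have e2 : deriv (fun z => a z * Θm z) c = deriv a c * Θm c + a c * deriv Θm c := by rw [dm]
  rw [e1, e2, ddM, ddm] at hsub
  rw [dSO, ddO]
  linarith [hsub]

end Class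

end Summit.NavierStokesRegularity.NavierStokesRegularity.Theorems.PoloidalWindowDoorLrcModEntireTwistingTHPlaneOscillationEnvelope
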